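import Summits.Ventures.PercRepro.ThetaOmegaCoreSquareRules

/-!
# The square lemma, II: the context of two bad two-edge points and its symmetries

Dossier proofs/MINE1-theoremS.md, Addendum 82 (mine-1, gen 43). Two bad two-edge points `q ≠ r`
(`BadTwo`) have edge families `K_q = {b, a}` and `K_r = {b', a'}` which are exceptional pairs
(`OmegaExcPair`, `two_le_omegaCount_of_pair`); after normalisation each lower end is K-mono
(`c0 (s + q) = c1 s`) or `∅`, the two `c1`-colours differ, and the credit is exactly the edge
`(∅, {q})` (`badTwo_edges`). The structure `SqCtx` records this data symmetrically in `b, a`, in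
`b', a'` and in the two points; `exists_sqCtx` produces it from `BadTwo`, and the four
symmetries `SqCtx.swap_ab`, `SqCtx.swap_ab'`, `SqCtx.swap_qr`, `SqCtx.compl` (the global colour
swap, under which the two families are invariant) are what the case analysis of the square lemma
is reduced by.
-/

namespace PercRepro.MSTight

open Finset

variable {α : Type*} [DecidableEq α]

section Ctx

/-- **The context of the square lemma**: two bad two-edge points `q ≠ r` of `U` with normalised
edge families `{b, a}` and `{b', a'}` — every lower end is a member whose `q`-neighbour (resp.
`r`-neighbour) is a member, K-mono or empty, the two `c1`-colours differ, and the credit of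
each point is exactly the singleton edge (no other `q`-edge of `A`, no `q`-edge of `C`). -/
structure SqCtx (U : Finset α) (F : Finset (Finset α)) (c0 c1 : Finset α → Bool) (q r : α)
    (b a b' a' : Finset α) : Prop where
  hqr : q ≠ r
  hqU : q ∈ U
  hrU : r ∈ U
  hb : b ∈ F
  hqb : q ∉ b
  hbq : insert q b ∈ F
  ha : a ∈ F
  hqa : q ∉ a
  haq : insert q a ∈ F
  hab : a ≠ b
  hKb : c0 (insert q b) = c1 b ∨ b = ∅
  hKa : c0 (insert q a) = c1 a ∨ a = ∅
  hopp : c1 a ≠ c1 b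
  hKq : qEdges q F = {b, a}
  hqA : ∀ d ∈ qEdges q (omegaA F c0 c1), d = ∅
  hqC : ∀ d, d ∉ qEdges q (omegaC U F c1)
  hb' : b' ∈ F
  hrb' : r ∉ b'
  hb'r : insert r b' ∈ F
  ha' : a' ∈ F
  hra' : r ∉ a'
  ha'r : insert r a' ∈ F
  hab' : a' ≠ b'
  hKb' : c0 (insert r b') = c1 b' ∨ b' = ∅
  hKa' : c0 (insert r a') = c1 a' ∨ a' = ∅
  hopp' : c1 a' ≠ c1 b'
  hKr : qEdges r F = {b', a'}
  hrA : ∀ d ∈ qEdges r (omegaA F c0 c1), d = ∅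
  hrC : ∀ d, d ∉ qEdges r (omegaC U F c1)

variable {U : Finset α} {F : Finset (Finset α)} {c0 c1 : Finset α → Bool} {q r : α}
  {b a b' a' : Finset α}

/-- The symmetry `a ↔ b` of the context. -/
theorem SqCtx.swap_ab (H : SqCtx U F c0 c1 q r b a b' a') : SqCtx U F c0 c1 q r a b b' a' where
  hqr := H.hqr
  hqU := H.hqU
  hrU := H.hrU
  hb := H.ha
  hqb := H.hqa
  hbq := H.haq
  ha := H.hb
  hqa := H.hqb
  haq := H.hbq
  hab := H.hab.symm
  hKb := H.hKa
  hKa := H.hKb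
  hopp := H.hopp.symm
  hKq := by rw [H.hKq, pair_comm]
  hqA := H.hqA
  hqC := H.hqC
  hb' := H.hb'
  hrb' := H.hrb'
  hb'r := H.hb'r
  ha' := H.ha'
  hra' := H.hra'
  ha'r := H.ha'r
  hab' := H.hab'
  hKb' := H.hKb'
  hKa' := H.hKa'
  hopp' := H.hopp'
  hKr := H.hKr
  hrA := H.hrA
  hrC := H.hrC

/-- The symmetry `a' ↔ b'` of the context. -/
theorem SqCtx.swap_ab' (H : SqCtx U F c0 c1 q r b a b' a') : SqCtx U F c0 c1 q r b a a' b' where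
  hqr := H.hqr
  hqU := H.hqU
  hrU := H.hrU
  hb := H.hb
  hqb := H.hqb
  hbq := H.hbq
  ha := H.ha
  hqa := H.hqa
  haq := H.haq
  hab := H.hab
  hKb := H.hKb
  hKa := H.hKa
  hopp := H.hopp
  hKq := H.hKq
  hqA := H.hqA
  hqC := H.hqC
  hb' := H.ha'
  hrb' := H.hra'
  hb'r := H.ha'r
  ha' := H.hb'
  hra' := H.hrb'
  ha'r := H.hb'r
  hab' := H.hab'.symm
  hKb' := H.hKa'
  hKa' := H.hKb'
  hopp' := H.hopp'.symm
  hKr := by rw [H.hKr, pair_comm]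
  hrA := H.hrA
  hrC := H.hrC

/-- The symmetry `q ↔ r` of the context. -/
theorem SqCtx.swap_qr (H : SqCtx U F c0 c1 q r b a b' a') : SqCtx U F c0 c1 r q b' a' b a where
  hqr := H.hqr.symm
  hqU := H.hrU
  hrU := H.hqU
  hb := H.hb'
  hqb := H.hrb'
  hbq := H.hb'r
  ha := H.ha'
  hqa := H.hra'
  haq := H.ha'r
  hab := H.hab'
  hKb := H.hKb'
  hKa := H.hKa'
  hopp := H.hopp'
  hKq := H.hKr
  hqA := H.hrA
  hqC := H.hrC
  hb' := H.hb
  hrb' := H.hqb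
  hb'r := H.hbq
  ha' := H.ha
  hra' := H.hqa
  ha'r := H.haq
  hab' := H.hab
  hKb' := H.hKb
  hKa' := H.hKa
  hopp' := H.hopp
  hKr := H.hKq
  hrA := H.hqA
  hrC := H.hqC

/-- The global colour swap `(c0, c1) ↦ (!c0, !c1)` preserves the context. -/
theorem SqCtx.compl (H : SqCtx U F c0 c1 q r b a b' a') :
    SqCtx U F (fun s => !c0 s) (fun s => !c1 s) q r b a b' a' where
  hqr := H.hqr
  hqU := H.hqU
  hrU := H.hrU
  hb := H.hb
  hqb := H.hqb
  hbq := H.hbq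
  ha := H.ha
  hqa := H.hqa
  haq := H.haq
  hab := H.hab
  hKb := H.hKb.imp (fun h => by show (!c0 (insert q b)) = !c1 b; rw [h]) id
  hKa := H.hKa.imp (fun h => by show (!c0 (insert q a)) = !c1 a; rw [h]) id
  hopp := fun h => H.hopp (Bool.not_inj h)
  hKq := H.hKq
  hqA := by rw [omegaA_not]; exact H.hqA
  hqC := by rw [omegaC_not]; exact H.hqC
  hb' := H.hb'
  hrb' := H.hrb'
  hb'r := H.hb'r
  ha' := H.ha'
  hra' := H.hra'
  ha'r := H.ha'r
  hab' := H.hab'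
  hKb' := H.hKb'.imp (fun h => by show (!c0 (insert r b')) = !c1 b'; rw [h]) id
  hKa' := H.hKa'.imp (fun h => by show (!c0 (insert r a')) = !c1 a'; rw [h]) id
  hopp' := fun h => H.hopp' (Bool.not_inj h)
  hKr := H.hKr
  hrA := by rw [omegaA_not]; exact H.hrA
  hrC := by rw [omegaC_not]; exact H.hrC

end Ctx

section Normalise

variable {U : Finset α} {F : Finset (Finset α)} {c0 c1 : Finset α → Bool} {q : α}

/-- **Normalisation of a bad two-edge point**: its edge family is a pair `{b, a}` of members with
`q`-neighbours in `F`, each K-mono (`c0 (s + q) = c1 s`) or empty, of different `c1`-colours, `b`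
K-mono; and its credit is exactly the singleton edge. -/
theorem badTwo_normalise (hq : BadTwo U F c0 c1 q) :
    ∃ b a : Finset α, a ≠ b ∧ b ∈ F ∧ q ∉ b ∧ insert q b ∈ F ∧ a ∈ F ∧ q ∉ a ∧ insert q a ∈ F ∧
      c0 (insert q b) = c1 b ∧ (c0 (insert q a) = c1 a ∨ a = ∅) ∧ c1 a ≠ c1 b ∧
      qEdges q F = {b, a} ∧ (∀ d ∈ qEdges q (omegaA F c0 c1), d = ∅) ∧
      ∀ d, d ∉ qEdges q (omegaC U F c1) := by
  have h2 := hq.2.1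
  obtain ⟨w, w', hww', hK⟩ := card_eq_two.1 h2
  have hwK : w ∈ qEdges q F := by rw [hK]; exact mem_insert_self w {w'}
  have hw'K : w' ∈ qEdges q F := by rw [hK]; exact mem_insert_of_mem (mem_singleton_self w')
  obtain ⟨hw, hqw, hvw⟩ := mem_qEdges.1 hwK
  obtain ⟨hw', hqw', hvw'⟩ := mem_qEdges.1 hw'K
  have hpair : OmegaExcPair (edgeC0 q c0) c1 w w' := by
    by_contra hnot
    have hexc := hq.2.2.1
    have := two_le_omegaCount_of_pair (U := U.erase q) hwK hw'K hww'
      (fun h => hnot (Or.inl h)) (fun h => hnot (Or.inr (Or.inl h)))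
      (fun h => hnot (Or.inr (Or.inr h)))
    omega
  rcases hpair with ⟨hmw, hmw', hne⟩ | ⟨hw0, hmw', hne⟩ | ⟨hw'0, hmw, hne⟩
  · refine ⟨w', w, hww', hw', hqw', hvw', hw, hqw, hvw, hmw', Or.inl hmw,
      fun h => hne ((hmw.trans h).trans hmw'.symm), ?_, ?_⟩
    · rw [hK, pair_comm]
    · exact badTwo_edges hq hw'K hmw'
  · refine ⟨w', w, hww', hw', hqw', hvw', hw, hqw, hvw, hmw', Or.inr hw0,
      fun h => hne (h.trans hmw'.symm), ?_, ?_⟩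
    · rw [hK, pair_comm]
    · exact badTwo_edges hq hw'K hmw'
  · exact ⟨w, w', Ne.symm hww', hw, hqw, hvw, hw', hqw', hvw', hmw, Or.inr hw'0,
      fun h => hne (h.trans hmw.symm), hK, badTwo_edges hq hwK hmw⟩

variable {r : α}

/-- **Two bad two-edge points give a context.** -/
theorem exists_sqCtx (hq : BadTwo U F c0 c1 q) (hr : BadTwo U F c0 c1 r) (hqr : q ≠ r) :
    ∃ b a b' a' : Finset α, SqCtx U F c0 c1 q r b a b' a' := by
  obtain ⟨b, a, hab, hb, hqb, hbq, ha, hqa, haq, hKb, hKa, hopp, hKq, hqA, hqC⟩ :=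
    badTwo_normalise hq
  obtain ⟨b', a', hab', hb', hrb', hb'r, ha', hra', ha'r, hKb', hKa', hopp', hKr, hrA, hrC⟩ :=
    badTwo_normalise hr
  exact ⟨b, a, b', a', ⟨hqr, hq.1, hr.1, hb, hqb, hbq, ha, hqa, haq, hab, Or.inl hKb, hKa, hopp,
    hKq, hqA, hqC, hb', hrb', hb'r, ha', hra', ha'r, hab', Or.inl hKb', hKa', hopp', hKr, hrA,
    hrC⟩⟩

end Normalise

end PercRepro.MSTight
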